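import Mathlib
import Literature.MathematicalPhysics.QuantumFieldTheory.Balaban1983to89.B14DomainGeom

/-!
# `Balaban1983to89.B14Eq213MaximalDomains` — T. Bałaban, *Convergent renormalization expansions for lattice gauge
# theories*, Commun. Math. Phys. **119** (1988) 243–285 [Balaban1988Convergent]: the construction behind (2.13)
# p. 256–257 — the MAXIMAL sequence of domains `Ω = Ω₀ ⊃ Ω₁ ⊃ … ⊃ Ω_j` generating the minimal determining set `𝐁_j(Ω)` —
# CONCRETE on the cube-partitioned lattice `ℤ^d` of `B14DomainGeom`, with the printed sentence *"It is easy to see that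
# dist(Ω_j, Ωᶜ) ≦ 2M₁, or Ω^{∼−2} ⊂ Ω_j"* PROVED

statement-level skeleton of published theorems with citation tags; proofs where landed; nothing here is a claim about the Yang–Mills mass gap

PDF held: `paper:balaban1988-cmp119-convergent-renormalization` (journal page = PDF page + 242); pp. 256–257 read on the
x2 renders `…-p014-x2.png`, `…-p015-x2.png` of
`run/shared/lean/pub/pub-balaban/b2b-balaban-ref1/pages/1988-cmp119-convergent-renormalization/`.

CITATION HEADER (lean-in-tree rule).  WHAT IS REPRODUCED, verbatim, p. 256–257 [PDF 14–15]: *"Consider a domain Ω such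
that it is a union of M₁-cubes in the lattice T_ξ, ξ = L^{−j}. For this domain we build a minimal determining set with a
support in Ω, or a sequence of maximal domains Ω = Ω₀ ⊃ Ω₁ ⊃ .... ⊃ Ω_j such that Ω_n is a union of LⁿξM₁-cubes, and
dist(Ω_n, Ωᶜ_{n−1}) ≧ LⁿξM₁, n = 1, ...., j (the distance is for the lattice T_ξ). It is easy to see that
dist(Ω_j, Ωᶜ) ≦ 2M₁, or Ω^{∼−2} ⊂ Ω_j, where the operation ∼ is taken for M₁-cubes. We denote this determining set by
𝐁_j(Ω), and the corresponding minimal configurations by U(𝐁_j(Ω), ·) = U_{j,Ω}(·). (2.13)"* — SKELETON row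
**B14.Eq2.13** (the concrete construction, listed «concrete construction absent» in ROWS-B14 ≤ v1.16; the abstract
determining-set calculus is `B16Cor3Wilson` §4 / r12's `B15DeterminingSets`).

THE TYPED READING (lattice units of `T_ξ`, so the LⁿξM₁-cubes have side `s_n = LⁿM₁` sites, `side L M₁ n`; the
M₁-cubes of `T_ξ` are the `s_j`-cubes; distances are sup-distances as in `B14DomainGeom` — [I] p. 257 defines the
enlargement `X̃ⁿ` by cube layers, i.e. in the sup-metric; with the Euclidean distance the constraint
`dist(Ω_n, Ωᶜ_{n−1}) ≧ LⁿξM₁` is weaker, the maximal domains larger, and `innerN_two_subset_maxDom` holds a fortiori).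
`maxDom L M₁ Ω n` = `Ω_n` is DEFINED by the maximal choice: `Ω₀ = Ω`, and `x ∈ Ω_{n+1}` iff every point within
sup-distance `< s_{n+1}` of the `s_{n+1}`-cube of `x` lies in `Ω_n`.  PROVED: `Ω_n` is a union of `s_n`-cubes
(`isUnionOfCubes_maxDom_succ`; for `n = 0` from the hypothesis on `Ω`, `isUnionOfCubes_maxDom`), the sequence decreases
(`maxDom_succ_subset`, `maxDom_subset`), the printed distance condition (`dist_maxDom`), MAXIMALITY — every sequence with
the three printed properties lies inside termwise (`seq_subset_maxDom`) —, the layers `Ω_n ∖ Ω_{n+1}` (`n < j`), `Ω_j`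
partition `Ω` (*"with a support in Ω"*, `layer_disjoint`, `layer_subset`, `mem_layer_of_mem`), and the sentence *"It is
easy to see that … Ω^{∼−2} ⊂ Ω_j"*: `innerN (side L M₁ j) 2 Ω ⊆ maxDom L M₁ Ω j` for `L ≥ 2` (`innerN_two_subset_maxDom`;
the reach of the nested constraints from an `s_j`-cube is `Σ_{n=1}^{j} s_n ≤ 2s_j`, `reach_le`).  The first half of the
printed sentence, *"dist(Ω_j, Ωᶜ) ≦ 2M₁"*, is its paraphrase (every M₁-cube of `Ω` two cube layers away from `Ωᶜ` is in
`Ω_j`) and is not typed separately.  (2.13) itself NAMES the minimal configurations `U(𝐁_j(Ω), ·)` of [15] for this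
determining set — no further content to type here (rows B14.Eq2.12, B11.Thm1).

Mega-formalization `lit-balaban`, unit `lit-balaban-r11` gen 4 (B14 fold owner; the «concrete construction absent» clause
of row B14.Eq2.13), HOME `run/shared/lean/pub/lit-balaban/`.

v1.1 (gen 64, DOCSTRING-ONLY citation-locator fix; summit-lit1 CITELOC row P31-210 of gen 31, decision of record «(B14, (2.13),
p.256) → p.257», never relayed to this seat): the 24 per-declaration tags read «(2.13) p.256»; the display (2.13) itself is the FIRST
display of p. 257 [PDF 15] (text layer p0015 L3 «U(𝐁_j(Ω), ·) = U_{j,Ω}(·). (2.13)»), while every sentence this file types — the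
maximal domains, «Ω_n is a union of LⁿξM₁-cubes», the distance condition, «It is easy to see that dist(Ω_j, Ωᶜ) ≦ 2M₁, or
Ω^{∼−2} ⊂ Ω_j» — sits at the foot of p. 256 [PDF 14] (p0014 L28–34); the tags now read «(2.13) pp.256–257», the locator of the
module header and of ROWS-B14 row B14.Eq2.13 (the wording summit-lit1 accepted on the sibling rows P69-001 ∕ P79-003); prose
page mentions «p. 256» for those sentences are correct and unchanged; no declaration changed.

## References
* [Balaban1988Convergent] T. Bałaban, Commun. Math. Phys. 119 (1988) 243–285, (2.13) pp. 256–257.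
* [Balaban1987RG1] T. Bałaban, Commun. Math. Phys. 109 (1987) 249–301, p. 257 (the enlargement `X̃ⁿ` by cube layers).
-/

namespace Literature.MathematicalPhysics.QuantumFieldTheory.Balaban1983to89.B14.Eq213MaximalDomains

open Literature.MathematicalPhysics.QuantumFieldTheory.Balaban1983to89.B14DomainGeom

variable {d : ℕ}

/-! ## §1. Sides, cubes, index arithmetic -/

/-- The side of the `LⁿξM₁`-cubes of `T_ξ` in lattice units: `s_n = LⁿM₁` (p. 256: *"Ω_n is a union of LⁿξM₁-cubes"*).
[cite: Balaban1988Convergent, (2.13) pp.256–257] -/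
def side (L M₁ n : ℕ) : ℕ := L ^ n * M₁

/-- `s_{n+1} = L·s_n` (the partitions are nested). [cite: Balaban1988Convergent, (2.13) pp.256–257] -/
theorem side_succ (L M₁ n : ℕ) : side L M₁ (n+1) = L * side L M₁ n := by
  unfold side; ring

/-- `s_n ≥ 1` for `L, M₁ ≥ 1`. [cite: Balaban1988Convergent, (2.13) pp.256–257] -/
theorem side_pos {L M₁ : ℕ} (hL : 1 ≤ L) (hM : 1 ≤ M₁) (n : ℕ) : 0 < side L M₁ n :=
  Nat.mul_pos (Nat.pow_pos (by omega)) hM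

/-- A point lies in its own cube: `s·a_i ≤ x_i ≤ s·a_i + s − 1` for `a = cubeIdx s x`. [folklore] -/
private theorem cube_bounds (s : ℕ) (hs : 0 < s) (x : Pt d) (i : Fin d) :
    (s : ℤ) * cubeIdx s x i ≤ x i ∧ x i ≤ (s : ℤ) * cubeIdx s x i + s - 1 :=
  ⟨cubeIdx_le s hs x i, by have := lt_cubeIdx s hs x i; omega⟩

/-- Lower index bound from a lower coordinate bound: `s·c ≤ z_i ⇒ c ≤ cubeIdx s z i`. [folklore] -/
private theorem le_cubeIdx_of_le (s : ℕ) (hs : 0 < s) (z : Pt d) (i : Fin d) (c : ℤ) (h : (s : ℤ) * c ≤ z i) :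
    c ≤ cubeIdx s z i := by
  unfold cubeIdx
  exact (Int.le_ediv_iff_mul_le (by exact_mod_cast hs)).2 (by rw [mul_comm]; exact h)

/-- Upper index bound from a strict upper coordinate bound: `z_i < s·c ⇒ cubeIdx s z i < c`. [folklore] -/
private theorem cubeIdx_lt_of_lt (s : ℕ) (hs : 0 < s) (z : Pt d) (i : Fin d) (c : ℤ) (h : z i < (s : ℤ) * c) :
    cubeIdx s z i < c := by
  unfold cubeIdx
  exact (Int.ediv_lt_iff_lt_mul (by exact_mod_cast hs)).2 (by rw [mul_comm]; exact h)

/-- A union of `s·t`-cubes is a union of `s`-cubes (nested partitions: the M₁-cubes of `T_ξ`, i.e. the `s_j`-cubes, are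
unions of `s_n`-cubes for every `n ≤ j`). [folklore] -/
private theorem isUnionOfCubes_of_mul {s t : ℕ} {Λ : Set (Pt d)} (h : IsUnionOfCubes (s * t) Λ) :
    IsUnionOfCubes s Λ := by
  intro x y hxy
  apply h
  funext i
  have hi := congrFun hxy i
  unfold cubeIdx at hi ⊢
  push_cast
  rw [← Int.ediv_ediv_of_nonneg (Int.natCast_nonneg s), ← Int.ediv_ediv_of_nonneg (Int.natCast_nonneg s), hi]

/-- The `w`-collar of the `s`-cube of index `a` in the sup-metric: `{z : s·a_i − w ≤ z_i ≤ s·a_i + s − 1 + w}`.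
[folklore] -/
def cubeExt (s : ℕ) (a : Pt d) (w : ℤ) : Set (Pt d) :=
  {z | ∀ i, (s : ℤ) * a i - w ≤ z i ∧ z i ≤ (s : ℤ) * a i + s - 1 + w}

/-- A point of the cube lies in every nonnegative collar of it. [folklore] -/
private theorem mem_cubeExt_of_cubeIdx (s : ℕ) (hs : 0 < s) {x : Pt d} {a : Pt d} (hx : cubeIdx s x = a) {w : ℤ}
    (hw : 0 ≤ w) : x ∈ cubeExt s a w := by
  intro i
  have hb := cube_bounds s hs x i
  rw [hx] at hb
  exact ⟨by linarith [hb.1], by linarith [hb.2]⟩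

/-! ## §2. The maximal sequence `Ω = Ω₀ ⊃ Ω₁ ⊃ … ⊃ Ω_j` -/

/-- **The maximal domains of p. 256**, DEFINED: `Ω₀ = Ω`; `x ∈ Ω_{n+1}` iff every point `y` within sup-distance
`≦ s_{n+1} − 1` of some point `x′` of the `s_{n+1}`-cube of `x` lies in `Ω_n` — the largest union of `L^{n+1}ξM₁`-cubes
with `dist(Ω_{n+1}, Ωᶜ_n) ≧ L^{n+1}ξM₁` (`seq_subset_maxDom`). [cite: Balaban1988Convergent, (2.13) pp.256–257] -/
def maxDom (L M₁ : ℕ) (Ω : Set (Pt d)) : ℕ → Set (Pt d)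
  | 0 => Ω
  | n+1 => {x | ∀ x' : Pt d, cubeIdx (side L M₁ (n+1)) x' = cubeIdx (side L M₁ (n+1)) x →
      ∀ y : Pt d, Within ((side L M₁ (n+1) : ℤ) - 1) x' y → y ∈ maxDom L M₁ Ω n}

/-- `Ω₀ = Ω`. [cite: Balaban1988Convergent, (2.13) pp.256–257] -/
@[simp] theorem maxDom_zero (L M₁ : ℕ) (Ω : Set (Pt d)) : maxDom L M₁ Ω 0 = Ω := rfl

/-- Unfolding of `Ω_{n+1}`. [cite: Balaban1988Convergent, (2.13) pp.256–257] -/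
theorem mem_maxDom_succ (L M₁ : ℕ) (Ω : Set (Pt d)) (n : ℕ) (x : Pt d) :
    x ∈ maxDom L M₁ Ω (n+1) ↔ ∀ x' : Pt d, cubeIdx (side L M₁ (n+1)) x' = cubeIdx (side L M₁ (n+1)) x →
      ∀ y : Pt d, Within ((side L M₁ (n+1) : ℤ) - 1) x' y → y ∈ maxDom L M₁ Ω n :=
  Iff.rfl

/-- *"Ω_n is a union of LⁿξM₁-cubes"* (`n ≥ 1`; by construction). [cite: Balaban1988Convergent, (2.13) pp.256–257] -/
theorem isUnionOfCubes_maxDom_succ (L M₁ : ℕ) (Ω : Set (Pt d)) (n : ℕ) :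
    IsUnionOfCubes (side L M₁ (n+1)) (maxDom L M₁ Ω (n+1)) := by
  intro x y hxy
  simp only [mem_maxDom_succ, hxy]

/-- *"Ω_n is a union of LⁿξM₁-cubes"* for every `n ≤ j`, `Ω = Ω₀` included, when `Ω` *"is a union of M₁-cubes in the
lattice T_ξ"* (the `s_j`-cubes). [cite: Balaban1988Convergent, (2.13) pp.256–257] -/
theorem isUnionOfCubes_maxDom {L M₁ : ℕ} {Ω : Set (Pt d)} {j : ℕ}
    (hΩ : IsUnionOfCubes (side L M₁ j) Ω) {n : ℕ} (hn : n ≤ j) :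
    IsUnionOfCubes (side L M₁ n) (maxDom L M₁ Ω n) := by
  cases n with
  | zero =>
    obtain ⟨m, rfl⟩ := Nat.exists_eq_add_of_le hn
    have h' : IsUnionOfCubes (side L M₁ 0 * L ^ m) Ω := by
      have : side L M₁ (0 + m) = side L M₁ 0 * L ^ m := by unfold side; ring
      rw [← this]; exact hΩ
    exact isUnionOfCubes_of_mul h'
  | succ n => exact isUnionOfCubes_maxDom_succ L M₁ Ω n

/-- **The printed distance condition** *"dist(Ω_n, Ωᶜ_{n−1}) ≧ LⁿξM₁"*: no point of `Ωᶜ_n` lies within sup-distance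
`< s_{n+1}` of `Ω_{n+1}`. [cite: Balaban1988Convergent, (2.13) pp.256–257] -/
theorem dist_maxDom (L M₁ : ℕ) (Ω : Set (Pt d)) (n : ℕ) {x : Pt d} (hx : x ∈ maxDom L M₁ Ω (n+1))
    {y : Pt d} (hy : Within ((side L M₁ (n+1) : ℤ) - 1) x y) : y ∈ maxDom L M₁ Ω n :=
  hx x rfl y hy

/-- *"Ω₀ ⊃ Ω₁ ⊃ … ⊃ Ω_j"*: `Ω_{n+1} ⊆ Ω_n`. [cite: Balaban1988Convergent, (2.13) pp.256–257] -/
theorem maxDom_succ_subset {L M₁ : ℕ} (hL : 1 ≤ L) (hM : 1 ≤ M₁) (Ω : Set (Pt d)) (n : ℕ) :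
    maxDom L M₁ Ω (n+1) ⊆ maxDom L M₁ Ω n := fun x hx =>
  dist_maxDom L M₁ Ω n hx (Within.refl (by have := side_pos hL hM (n+1); omega) x)

/-- `Ω_n ⊆ Ω_m` for `m ≤ n`. [cite: Balaban1988Convergent, (2.13) pp.256–257] -/
theorem maxDom_antitone {L M₁ : ℕ} (hL : 1 ≤ L) (hM : 1 ≤ M₁) (Ω : Set (Pt d)) {m n : ℕ} (h : m ≤ n) :
    maxDom L M₁ Ω n ⊆ maxDom L M₁ Ω m := by
  induction h with
  | refl => exact le_rfl
  | step _ ih => exact (maxDom_succ_subset hL hM Ω _).trans ih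

/-- `Ω_n ⊆ Ω` (*"a minimal determining set with a support in Ω"*). [cite: Balaban1988Convergent, (2.13) pp.256–257] -/
theorem maxDom_subset {L M₁ : ℕ} (hL : 1 ≤ L) (hM : 1 ≤ M₁) (Ω : Set (Pt d)) (n : ℕ) :
    maxDom L M₁ Ω n ⊆ Ω :=
  maxDom_antitone hL hM Ω (Nat.zero_le n)

/-- The maximal sequence is monotone in `Ω`. [cite: Balaban1988Convergent, (2.13) pp.256–257] -/
theorem maxDom_mono (L M₁ : ℕ) {Ω Ω' : Set (Pt d)} (h : Ω ⊆ Ω') (n : ℕ) :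
    maxDom L M₁ Ω n ⊆ maxDom L M₁ Ω' n := by
  induction n with
  | zero => exact h
  | succ n ih => exact fun x hx x' hx' y hy => ih (hx x' hx' y hy)

/-- **MAXIMALITY** (*"a sequence of maximal domains"*): every sequence `D₀ ⊆ Ω`, `D_n` a union of `LⁿξM₁`-cubes
(`n ≥ 1`) with `dist(D_n, Dᶜ_{n−1}) ≧ LⁿξM₁` lies inside the constructed one termwise: `D_n ⊆ Ω_n`.
[cite: Balaban1988Convergent, (2.13) pp.256–257] -/
theorem seq_subset_maxDom (L M₁ : ℕ) (Ω : Set (Pt d)) (D : ℕ → Set (Pt d)) (h0 : D 0 ⊆ Ω)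
    (hcubes : ∀ n, IsUnionOfCubes (side L M₁ (n+1)) (D (n+1)))
    (hdist : ∀ n, ∀ x ∈ D (n+1), ∀ y, Within ((side L M₁ (n+1) : ℤ) - 1) x y → y ∈ D n) :
    ∀ n, D n ⊆ maxDom L M₁ Ω n := by
  intro n
  induction n with
  | zero => exact h0
  | succ n ih =>
    intro x hx x' hx' y hy
    exact ih (hdist n x' ((hcubes n x' x hx').2 hx) y hy)

/-! ## §3. The layers: the determining set `𝐁_j(Ω)` is generated by `{Ω_n}` via (2.2) -/

/-- The regions carrying the scales of `𝐁_j(Ω)` ((2.2) applied to the sequence `{Ω_n}`): `Ω_n ∖ Ω_{n+1}` for `n < j` and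
`Ω_j` for `n = j` (as point sets of `T_ξ`; the superscript `(n)` of (2.2) — passage to the `n`-lattice points — is the
coarse-graining of r12's `B15DeterminingSets.pts`, not repeated here); empty for `n > j`.
[cite: Balaban1988Convergent, (2.13) pp.256–257] -/
def layer (L M₁ : ℕ) (Ω : Set (Pt d)) (j n : ℕ) : Set (Pt d) :=
  if n < j then maxDom L M₁ Ω n \ maxDom L M₁ Ω (n+1) else if n = j then maxDom L M₁ Ω j else ∅

/-- Every layer lies in the maximal domain of its scale. [cite: Balaban1988Convergent, (2.13) pp.256–257] -/
theorem layer_subset_maxDom (L M₁ : ℕ) (Ω : Set (Pt d)) (j n : ℕ) : layer L M₁ Ω j n ⊆ maxDom L M₁ Ω n := by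
  intro z hz
  unfold layer at hz
  split_ifs at hz with h1 h2
  · exact hz.1
  · rw [h2]; exact hz
  · exact absurd hz (Set.notMem_empty z)

/-- The layers are pairwise disjoint. [cite: Balaban1988Convergent, (2.13) pp.256–257] -/
theorem layer_disjoint {L M₁ : ℕ} (hL : 1 ≤ L) (hM : 1 ≤ M₁) (Ω : Set (Pt d)) (j : ℕ) {m n : ℕ} (hmn : m < n) :
    Disjoint (layer L M₁ Ω j m) (layer L M₁ Ω j n) := by
  rw [Set.disjoint_left]
  intro x hxm hxn
  have hxn' : x ∈ maxDom L M₁ Ω (m+1) :=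
    maxDom_antitone hL hM Ω (Nat.succ_le_of_lt hmn) (layer_subset_maxDom L M₁ Ω j n hxn)
  unfold layer at hxm hxn
  split_ifs at hxm with h1 h2
  · exact hxm.2 hxn'
  · subst h2
    rw [if_neg (not_lt.2 hmn.le), if_neg (ne_of_gt hmn)] at hxn
    exact hxn
  · exact hxm

/-- *"with a support in Ω"*: every layer lies in `Ω`. [cite: Balaban1988Convergent, (2.13) pp.256–257] -/
theorem layer_subset {L M₁ : ℕ} (hL : 1 ≤ L) (hM : 1 ≤ M₁) (Ω : Set (Pt d)) (j n : ℕ) :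
    layer L M₁ Ω j n ⊆ Ω :=
  (layer_subset_maxDom L M₁ Ω j n).trans (maxDom_subset hL hM Ω n)

/-- The layers exhaust `Ω`: every point of `Ω` lies in the layer of the last `n ≤ j` with `x ∈ Ω_n`.
[cite: Balaban1988Convergent, (2.13) pp.256–257] -/
theorem mem_layer_of_mem (L M₁ : ℕ) (Ω : Set (Pt d)) (j : ℕ) {x : Pt d} (hx : x ∈ Ω) :
    ∃ n ≤ j, x ∈ layer L M₁ Ω j n := by
  classical
  by_cases hj : x ∈ maxDom L M₁ Ω j
  · exact ⟨j, le_rfl, by unfold layer; rw [if_neg (lt_irrefl j), if_pos rfl]; exact hj⟩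
  · -- the first index `n < j` with `x ∉ Ω_{n+1}`; then `x ∈ Ω_n` by minimality
    have hex : ∃ n, n < j ∧ x ∉ maxDom L M₁ Ω (n+1) := by
      cases j with
      | zero => exact absurd hx hj
      | succ j => exact ⟨j, Nat.lt_succ_self j, hj⟩
    have hn : Nat.find hex < j ∧ x ∉ maxDom L M₁ Ω (Nat.find hex + 1) := Nat.find_spec hex
    have hxn : x ∈ maxDom L M₁ Ω (Nat.find hex) := by
      rcases Nat.eq_zero_or_pos (Nat.find hex) with h0 | hpos
      · rw [h0]; exact hx
      · obtain ⟨m, hm⟩ : ∃ m, Nat.find hex = m + 1 := ⟨Nat.find hex - 1, by omega⟩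
        have hmin := Nat.find_min hex (show m < Nat.find hex by omega)
        rw [hm]
        by_contra hxm
        exact hmin ⟨by omega, hxm⟩
    exact ⟨Nat.find hex, hn.1.le, by unfold layer; rw [if_pos hn.1]; exact ⟨hxn, hn.2⟩⟩

/-! ## §4. *"It is easy to see that dist(Ω_j, Ωᶜ) ≦ 2M₁, or Ω^{∼−2} ⊂ Ω_j"* -/

/-- The reach of the nested constraints from an `s_n`-cube: `w_n = s_1 + s_2 + … + s_n` (a point whose `s_n`-cube has its
`w_n`-collar inside `Ω` survives to `Ω_n`, `cube_subset_maxDom_of_ext`). [cite: Balaban1988Convergent, (2.13) pp.256–257] -/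
def reach (L M₁ : ℕ) : ℕ → ℕ
  | 0 => 0
  | n+1 => side L M₁ (n+1) + reach L M₁ n

/-- `w_n ≤ 2 s_n` for `L ≥ 2` (geometric series: `M₁(L + … + Lⁿ) ≤ 2LⁿM₁`). [cite: Balaban1988Convergent, (2.13) pp.256–257] -/
theorem reach_le {L : ℕ} (hL : 2 ≤ L) (M₁ n : ℕ) : reach L M₁ n ≤ 2 * side L M₁ n := by
  induction n with
  | zero => simp [reach]
  | succ n ih =>
    have h1 : 2 * side L M₁ n ≤ side L M₁ (n+1) := by
      rw [side_succ]; exact Nat.mul_le_mul_right _ hL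
    simp only [reach]
    omega

/-- **Key step.** If the `w_n`-collar of the `s_n`-cube of index `a` lies in `Ω`, the whole cube lies in `Ω_n`
(induction on `n`: the points tested by the level-`n+1` constraint lie in the aligned `s_{n+1}`-block around the cube,
whose `s_n`-cubes have their `w_n`-collars inside the `w_{n+1} = s_{n+1} + w_n`-collar). [cite: Balaban1988Convergent, (2.13) pp.256–257] -/
theorem cube_subset_maxDom_of_ext {L M₁ : ℕ} (hL : 1 ≤ L) (hM : 1 ≤ M₁) (Ω : Set (Pt d)) :
    ∀ (n : ℕ) (a : Pt d), cubeExt (side L M₁ n) a (reach L M₁ n) ⊆ Ω →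
      ∀ x : Pt d, cubeIdx (side L M₁ n) x = a → x ∈ maxDom L M₁ Ω n := by
  intro n
  induction n with
  | zero =>
    intro a hext x hx
    exact hext (mem_cubeExt_of_cubeIdx _ (side_pos hL hM 0) hx (by simp [reach]))
  | succ n ih =>
    intro a hext x hx x' hx' y hy
    have hs : 0 < side L M₁ n := side_pos hL hM n
    have hS : 0 < side L M₁ (n+1) := side_pos hL hM (n+1)
    have hSL : (side L M₁ (n+1) : ℤ) = (side L M₁ n : ℤ) * L := by rw [side_succ]; push_cast; ring
    refine ih (cubeIdx (side L M₁ n) y) ?_ y rfl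
    intro z hz
    apply hext
    intro i
    have hxa : cubeIdx (side L M₁ (n+1)) x' = a := by rw [hx', hx]
    have hb := cube_bounds (side L M₁ (n+1)) hS x' i
    rw [hxa] at hb
    have hyi : |x' i - y i| ≤ (side L M₁ (n+1) : ℤ) - 1 := hy i
    have hy1 : (side L M₁ (n+1) : ℤ) * a i - side L M₁ (n+1) + 1 ≤ y i := by
      have := (abs_le.1 hyi).2; linarith [hb.1]
    have hy2 : y i ≤ (side L M₁ (n+1) : ℤ) * a i + 2 * side L M₁ (n+1) - 2 := by
      have := (abs_le.1 hyi).1; linarith [hb.2]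
    -- the `s_n`-cube of `y` lies in the aligned `s_{n+1}`-block around the cube of index `a`
    have hup : cubeIdx (side L M₁ n) y i + 1 ≤ (L : ℤ) * (a i + 2) := by
      have : cubeIdx (side L M₁ n) y i < (L : ℤ) * (a i + 2) :=
        cubeIdx_lt_of_lt (side L M₁ n) hs y i _ (by rw [← mul_assoc, ← hSL]; linarith)
      omega
    have hlo : (L : ℤ) * (a i - 1) ≤ cubeIdx (side L M₁ n) y i :=
      le_cubeIdx_of_le (side L M₁ n) hs y i _ (by rw [← mul_assoc, ← hSL]; linarith)
    have hz' := hz i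
    have hreach : (reach L M₁ (n+1) : ℤ) = side L M₁ (n+1) + reach L M₁ n := by simp [reach]
    have hsn : (0 : ℤ) ≤ side L M₁ n := by exact_mod_cast hs.le
    constructor
    · have h1 : (side L M₁ (n+1) : ℤ) * (a i - 1) ≤ (side L M₁ n : ℤ) * cubeIdx (side L M₁ n) y i := by
        rw [hSL, mul_assoc]; exact mul_le_mul_of_nonneg_left hlo hsn
      linarith [hz'.1]
    · have h2 : (side L M₁ n : ℤ) * (cubeIdx (side L M₁ n) y i + 1) ≤ (side L M₁ (n+1) : ℤ) * (a i + 2) := by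
        rw [hSL, mul_assoc]; exact mul_le_mul_of_nonneg_left hup hsn
      linarith [hz'.2]

/-- **p. 256, PROVED**: *"It is easy to see that dist(Ω_j, Ωᶜ) ≦ 2M₁, or Ω^{∼−2} ⊂ Ω_j, where the operation ∼ is taken
for M₁-cubes"* — `Ω` shrunk by two layers of its `s_j`-cubes (`B14DomainGeom.innerN`) lies in the last maximal domain,
for every `L ≥ 2`, `M₁ ≥ 1`. [cite: Balaban1988Convergent, (2.13) pp.256–257] -/
theorem innerN_two_subset_maxDom {L M₁ : ℕ} (hL : 2 ≤ L) (hM : 1 ≤ M₁) (Ω : Set (Pt d)) (j : ℕ) :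
    innerN (side L M₁ j) 2 Ω ⊆ maxDom L M₁ Ω j := by
  intro x hx
  have hL1 : 1 ≤ L := le_trans (by norm_num) hL
  have hs : 0 < side L M₁ j := side_pos hL1 hM j
  refine cube_subset_maxDom_of_ext hL1 hM Ω j (cubeIdx (side L M₁ j) x) ?_ x rfl
  intro z hz
  refine hx.2 z fun i => ?_
  have hz' := hz i
  have hr : (reach L M₁ j : ℤ) ≤ 2 * side L M₁ j := by exact_mod_cast reach_le hL M₁ j
  have h1 : cubeIdx (side L M₁ j) x i - 2 ≤ cubeIdx (side L M₁ j) z i :=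
    le_cubeIdx_of_le (side L M₁ j) hs z i _ (by linarith [hz'.1])
  have h2 : cubeIdx (side L M₁ j) z i < cubeIdx (side L M₁ j) x i + 3 :=
    cubeIdx_lt_of_lt (side L M₁ j) hs z i _ (by linarith [hz'.2])
  rw [abs_le]
  constructor <;> push_cast <;> omega

/-- The same for every `n ≤ j`: `Ω^{∼−2} ⊂ Ω_j ⊂ Ω_n`. [cite: Balaban1988Convergent, (2.13) pp.256–257] -/
theorem innerN_two_subset_maxDom_of_le {L M₁ : ℕ} (hL : 2 ≤ L) (hM : 1 ≤ M₁) (Ω : Set (Pt d)) {n j : ℕ}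
    (hn : n ≤ j) : innerN (side L M₁ j) 2 Ω ⊆ maxDom L M₁ Ω n :=
  (innerN_two_subset_maxDom hL hM Ω j).trans (maxDom_antitone (le_trans (by norm_num) hL) hM Ω hn)

/-! ## v1.1 (documentary, iface-2 row IF2-28 / Q-IF2-8, 2026-08-21): the generic home of the cube recursion

The recursion `maxDom` is, step by step, the CORE-CUBE operation of the substrate cell's small-field-domain calculus:
`maxDom L M₁ Ω (n+1) = Summit.QuantumFields.BalabanUV.T4Continuum.SmallFieldDomains.coreCubes (side L M₁ (n+1))
((side L M₁ (n+1) : ℤ) − 1) (maxDom L M₁ Ω n)` holds by `rfl`, and `layer L M₁ Ω j n = SmallFieldDomains.layer (maxDom L M₁ Ω) n`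
for `n < j` by `simp` (kernel-checked by `lit-balaban-iface-2` gen 13 in a scratch file; generic objects:
`lean/Summits/QuantumFields/BalabanUV/Support/SmallFieldDomainsTower.lean`, `…/Support/SmallFieldDomains.lean`).  A
Literature file cannot import `Summits/…/Support/`, so the identification is RECORDED there (registry row IF2-28, verdict
KEEP-BOTH) and only documented here; `isUnionOfCubes_maxDom_succ`, `dist_maxDom`, `maxDom_mono`, `maxDom_succ_subset`,
`seq_subset_maxDom` are the instances of the generic `isUnionOfCubes_coreCubes`, `coreCubes_deep`, `coreCubes_mono`,
`coreCubes_subset`, `subset_coreCubes_iff`.  Nothing in this file changed otherwise (append-only note). -/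

end Literature.MathematicalPhysics.QuantumFieldTheory.Balaban1983to89.B14.Eq213MaximalDomains
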